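import Summits.QuantumFields.BalabanUV.T4Continuum.Spine.NE5.NeumannChainWalks

/-!
# Spine/NE5/NeumannLevelSums — the LEVEL sums of the Neumann chain family: over all chains of a fixed length `N` and all
# seeds, the chain terms sum (entrywise, absolutely) to `K^N·C` where `K = Σ_i S_i` and `C = Σ_ω T_ω` (cell `pub-balaban-gaps`,
# seat `ne5` gen 5; third building block of T9 — the `HasSum` identification of `(A + tP)⁻¹` up to the final assembly, design note `T9-DESIGN.md`)

WHY.  `Spine/NE5/NeumannChainWalks` bounds every chain term and the partial sums of the whole (chain, seed) family.  To
identify the family's sum with the resolvent one first sums each LEVEL: with steps `S_i` summing to `K` and seeds `T_ω` to `C`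
(entrywise `HasSum`, absolutely by the walk majorants), the chains of length `N` — indexed by `(Fin N → ι) × W₀` — sum to
`K^N·C` ([B9] p. 422 read backwards: *"replace each operator in (3.130) by its random walk expansion"* = distributivity; the
linear-map version is `B9SectDWalk.sum_lists_chainOp`).  Kernel content: induction on `N` with the Cauchy product
`HasSum.mul` (summability from the majorants: bounded partial sums of non-negative families, `Summable.of_norm_bounded`) and
the reindexing `Fin.consEquiv`.
§2 then SUMS THE LEVELS (`hasSum_levels`: the whole (chain, seed) family over `List ι × W₀` is summable from a total majorant
and `Σ_N K^N·C` converges to its sum, `HasSum.sigma` through `List.equivSigmaTuple`), kills the remainder (`tendsto_level_zero`: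
`K^N·C → 0`) and proves the resolvent identity `one_sub_mul_tsum_eq`: `(1 − K)·X = C` by telescoping.  WHAT T9 STILL NEEDS after
this file: only the assembly `A(1 − K) = A + tP`, `X = (A + tP)⁻¹` on the walk data — `Spine/NE5/NeumannPencilCovariance`.

HONEST FRAMING.  Bookkeeping (infinite sums of finite-matrix entries) over hypothesis SHAPES; the families and constants are
HYPOTHESES; nothing of Bałaban's is constructed or asserted; NE5 NOT PRINTED ∕ NOT PROVED; (D4) NOT discharged; spine PROVED
0∕9; rung (B)+1 on a FIXED finite T⁴ — NOT continuum, NOT infinite volume, NOT mass gap, NOT Clay.  HONEST DEPENDENCY: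
continuum YM on T⁴ ⇐ BetaPertH ∧ nine spine estimates; BetaPertH ⇐ (D1) ∧ (D4) ∧ CAP+tail.  0 sorry, 0 def.

Sources: [B9] = T. Bałaban, CMP **99** (1985) [Balaban1985BackgroundPropagators] (3.130) p. 421, p. 422; [II] = CMP **116** (1988)
[Balaban1988RG2Cluster] p. 13.  Nothing here is a claim about the Yang–Mills mass gap.
-/

noncomputable section

namespace Summit.QuantumFields.BalabanUV.T4Continuum.Spine.NE5.NeumannLevelSums

open Metric Set Finset
open Literature.MathematicalPhysics.QuantumFieldTheory.Balaban1983to89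

variable {ι W₀ n q : Type} [Fintype n] [DecidableEq n]

omit [Fintype n] [DecidableEq n] in
/-- **Summability of an entry family from bounded partial sums of real majorants.** [folklore] -/
theorem summable_of_majorant {W : Type} {f : W → ℂ} {g : W → ℝ} (hle : ∀ ω, ‖f ω‖ ≤ g ω) {B : ℝ}
    (hsum : ∀ S : Finset W, ∑ ω ∈ S, g ω ≤ B) : Summable f :=
  Summable.of_norm_bounded (summable_of_sum_le (fun ω => (norm_nonneg _).trans (hle ω)) hsum) hle

/-- **THE LEVEL-`N` SUM OF THE CHAIN FAMILY IS `K^N·C`** (entrywise).  Steps `S_i` (square) with `Σ_i S_i = K` entrywise and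
real majorants `‖S_i a b‖ ≤ σ_i(a,b)` with bounded partial sums; seeds `T_ω` with `Σ_ω T_ω = C` entrywise; and for every
length `N` a real majorant `M_N` of the chains `‖(List.ofFn v).foldr (S · * ·) (T ω) a b‖ ≤ M_N (v, ω) a b` with bounded
partial sums over finite sets of `(Fin N → ι) × W₀` (supplied by `NeumannChainWalks.norm_chain_entry_le` ∕ `majSumLe_chain`).
Then for every `N`: `HasSum (fun (v, ω) => ((List.ofFn v).foldr (S · * ·) (T ω)) a b) ((K ^ N * C) a b)`.
[cite: Balaban1985BackgroundPropagators, (3.130) p.421, p.422] -/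
theorem hasSum_chain_level {S : ι → Matrix n n ℂ} {K : Matrix n n ℂ} {T : W₀ → Matrix n q ℂ} {C : Matrix n q ℂ}
    (hS : ∀ a k, HasSum (fun i => S i a k) (K a k))
    {σS : ι → n → n → ℝ} (hσS : ∀ i a k, ‖S i a k‖ ≤ σS i a k) {BS : n → n → ℝ}
    (hBS : ∀ (F : Finset ι) a k, ∑ i ∈ F, σS i a k ≤ BS a k)
    (hT : ∀ k b, HasSum (fun ω => T ω k b) (C k b))
    {M : (N : ℕ) → ((Fin N → ι) × W₀) → n → q → ℝ}
    (hM : ∀ N (v : (Fin N → ι) × W₀) k b, ‖((List.ofFn v.1).foldr (fun i A => S i * A) (T v.2)) k b‖ ≤ M N v k b)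
    {BM : ℕ → n → q → ℝ} (hBM : ∀ N (F : Finset ((Fin N → ι) × W₀)) k b, ∑ v ∈ F, M N v k b ≤ BM N k b) :
    ∀ (N : ℕ) (a : n) (b : q),
      HasSum (fun v : (Fin N → ι) × W₀ => ((List.ofFn v.1).foldr (fun i A => S i * A) (T v.2)) a b) ((K ^ N * C) a b) := by
  intro N
  induction N with
  | zero =>
      intro a b
      -- chains of length 0 are the seeds
      let e : W₀ ≃ (Fin 0 → ι) × W₀ := (Equiv.uniqueProd W₀ (Fin 0 → ι)).symm
      rw [← e.hasSum_iff]
      have hfun : (fun v : (Fin 0 → ι) × W₀ => ((List.ofFn v.1).foldr (fun i A => S i * A) (T v.2)) a b) ∘ e =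
          fun ω => T ω a b := by
        funext ω
        simp [e, Equiv.uniqueProd, List.ofFn_zero]
      rw [hfun, pow_zero, Matrix.one_mul]
      exact hT a b
  | succ N ih =>
      intro a b
      -- reindex chains of length N+1 as (first step, chain of length N)
      let e : ι × ((Fin N → ι) × W₀) ≃ (Fin (N + 1) → ι) × W₀ :=
        (Equiv.prodAssoc ι (Fin N → ι) W₀).symm.trans ((Fin.consEquiv fun _ => ι).prodCongr (Equiv.refl W₀))
      rw [← e.hasSum_iff]
      have hfun : (fun v : (Fin (N + 1) → ι) × W₀ => ((List.ofFn v.1).foldr (fun i A => S i * A) (T v.2)) a b) ∘ e =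
          fun p : ι × ((Fin N → ι) × W₀) =>
            ∑ k, S p.1 a k * ((List.ofFn p.2.1).foldr (fun i A => S i * A) (T p.2.2)) k b := by
        funext p
        simp only [Function.comp_apply, e, Equiv.trans_apply, Equiv.prodCongr_apply, Equiv.prodAssoc_symm_apply,
          Prod.map_apply, Equiv.refl_apply, Fin.consEquiv, Equiv.coe_fn_mk, List.ofFn_succ, Fin.cons_zero, Fin.cons_succ,
          List.foldr_cons, Matrix.mul_apply]
      rw [hfun, pow_succ', Matrix.mul_assoc, Matrix.mul_apply]
      refine hasSum_sum fun k _ => ?_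
      -- Cauchy product of the step expansion at (a,k) with the level-N chain sum at (k,b)
      have hf : Summable fun i : ι => σS i a k := summable_of_sum_le (fun i => (norm_nonneg _).trans (hσS i a k))
        fun F => hBS F a k
      have hg : Summable fun v : (Fin N → ι) × W₀ => M N v k b :=
        summable_of_sum_le (fun v => (norm_nonneg _).trans (hM N v k b)) fun F => hBM N F k b
      let f : ι → ℂ := fun i => S i a k
      let g : (Fin N → ι) × W₀ → ℂ := fun v => ((List.ofFn v.1).foldr (fun i A => S i * A) (T v.2)) k b
      have hfg : Summable fun x : ι × ((Fin N → ι) × W₀) => f x.1 * g x.2 := by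
        refine Summable.of_norm_bounded (hf.mul_of_nonneg hg (fun i => (norm_nonneg _).trans (hσS i a k))
          (fun v => (norm_nonneg _).trans (hM N v k b))) fun x => ?_
        exact (norm_mul_le (f x.1) (g x.2)).trans
          (mul_le_mul (hσS x.1 a k) (hM N x.2 k b) (norm_nonneg _) ((norm_nonneg _).trans (hσS x.1 a k)))
      exact HasSum.mul (f := f) (g := g) (hS a k) (ih k b) hfg

/-! ## §2. Summing the levels and the resolvent identity `(1 − K)·X = C` -/

/-- **THE LEVELS SUM UP** (absolute summability of the whole (chain, seed) family ⟹ `Σ_N K^N C` converges entrywise to the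
family's sum): with a real majorant `Mtot` of the chain terms over `List ι × W₀` whose partial sums are bounded (supplied by
`NeumannChainWalks.norm_chain_entry_le` + `majSumLe_chain`), the family is summable and `HasSum (fun N => (K^N·C) a b)
(Σ' (l,ω), chain(l,ω) a b)` (`HasSum.sigma` through the reindexing «(length, tuple, seed) ≃ (list, seed)», `List.equivSigmaTuple`). [cite: Balaban1985BackgroundPropagators, (3.130) p.421, p.422] -/
theorem hasSum_levels {S : ι → Matrix n n ℂ} {K : Matrix n n ℂ} {T : W₀ → Matrix n q ℂ} {C : Matrix n q ℂ}
    (hS : ∀ a k, HasSum (fun i => S i a k) (K a k))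
    {σS : ι → n → n → ℝ} (hσS : ∀ i a k, ‖S i a k‖ ≤ σS i a k) {BS : n → n → ℝ}
    (hBS : ∀ (F : Finset ι) a k, ∑ i ∈ F, σS i a k ≤ BS a k)
    (hT : ∀ k b, HasSum (fun ω => T ω k b) (C k b))
    {Mtot : List ι × W₀ → n → q → ℝ}
    (hMtot : ∀ (p : List ι × W₀) k b, ‖(p.1.foldr (fun i A => S i * A) (T p.2)) k b‖ ≤ Mtot p k b)
    {Btot : n → q → ℝ} (hBtot : ∀ (F : Finset (List ι × W₀)) k b, ∑ p ∈ F, Mtot p k b ≤ Btot k b) (a : n) (b : q) :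
    Summable (fun p : List ι × W₀ => (p.1.foldr (fun i A => S i * A) (T p.2)) a b) ∧
    HasSum (fun N : ℕ => (K ^ N * C : Matrix n q ℂ) a b) (∑' p : List ι × W₀, (p.1.foldr (fun i A => S i * A) (T p.2)) a b) := by
  classical
  have hsum : ∀ a b, Summable (fun p : List ι × W₀ => (p.1.foldr (fun i A => S i * A) (T p.2)) a b) :=
    fun a b => summable_of_majorant (fun p => hMtot p a b) (fun F => hBtot F a b)
  -- level majorants: restrict the total majorant along the injection `v ↦ List.ofFn v`
  have hlev := hasSum_chain_level hS hσS hBS hT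
    (M := fun N v k b => Mtot (List.ofFn v.1, v.2) k b) (fun N v k b => hMtot (List.ofFn v.1, v.2) k b)
    (BM := fun _ k b => Btot k b) (by
      intro N F k b
      have hinj : Set.InjOn (fun v : (Fin N → ι) × W₀ => ((List.ofFn v.1, v.2) : List ι × W₀)) ↑F := by
        intro v _ w _ h
        simp only [Prod.mk.injEq, List.ofFn_inj] at h
        exact Prod.ext h.1 h.2
      rw [← Finset.sum_image (f := fun p : List ι × W₀ => Mtot p k b) hinj]
      exact hBtot _ k b)
  refine ⟨hsum a b, ?_⟩
  -- reindex the total family by (length, tuple, seed) and sum the fibres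
  let e : (Σ N : ℕ, (Fin N → ι) × W₀) ≃ List ι × W₀ :=
    (Equiv.sigmaProdDistrib (fun N : ℕ => Fin N → ι) W₀).symm.trans (List.equivSigmaTuple.symm.prodCongr (Equiv.refl W₀))
  have he : ∀ p, e p = (List.ofFn p.2.1, p.2.2) := fun _ => rfl
  have htot : HasSum ((fun p : List ι × W₀ => (p.1.foldr (fun i A => S i * A) (T p.2)) a b) ∘ e)
      (∑' p : List ι × W₀, (p.1.foldr (fun i A => S i * A) (T p.2)) a b) :=
    (Equiv.hasSum_iff e).2 (hsum a b).hasSum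
  refine htot.sigma fun N => ?_
  simpa [Function.comp, he] using hlev N a b

/-- **THE NEUMANN REMAINDER DIES**: under the same data `(K^N·C) a b → 0` — the level-`N` sum is bounded by the level-`N` part of a
summable non-negative family (the total majorant), whose level sums tend to zero. [cite: Balaban1985BackgroundPropagators, (3.130) p.421] -/
theorem tendsto_level_zero {S : ι → Matrix n n ℂ} {K : Matrix n n ℂ} {T : W₀ → Matrix n q ℂ} {C : Matrix n q ℂ}
    (hS : ∀ a k, HasSum (fun i => S i a k) (K a k))
    {σS : ι → n → n → ℝ} (hσS : ∀ i a k, ‖S i a k‖ ≤ σS i a k) {BS : n → n → ℝ}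
    (hBS : ∀ (F : Finset ι) a k, ∑ i ∈ F, σS i a k ≤ BS a k)
    (hT : ∀ k b, HasSum (fun ω => T ω k b) (C k b))
    {Mtot : List ι × W₀ → n → q → ℝ}
    (hMtot : ∀ (p : List ι × W₀) k b, ‖(p.1.foldr (fun i A => S i * A) (T p.2)) k b‖ ≤ Mtot p k b)
    {Btot : n → q → ℝ} (hBtot : ∀ (F : Finset (List ι × W₀)) k b, ∑ p ∈ F, Mtot p k b ≤ Btot k b) (a : n) (b : q) :
    Filter.Tendsto (fun N : ℕ => (K ^ N * C : Matrix n q ℂ) a b) Filter.atTop (nhds 0) := by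
  classical
  -- the total majorant, reindexed by (length, tuple, seed), is summable; its level sums are summable in N
  let e : (Σ N : ℕ, (Fin N → ι) × W₀) ≃ List ι × W₀ :=
    (Equiv.sigmaProdDistrib (fun N : ℕ => Fin N → ι) W₀).symm.trans (List.equivSigmaTuple.symm.prodCongr (Equiv.refl W₀))
  have he : ∀ p, e p = (List.ofFn p.2.1, p.2.2) := fun _ => rfl
  have hG : Summable ((fun p : List ι × W₀ => Mtot p a b) ∘ e) :=
    (Equiv.summable_iff e).2 (summable_of_sum_le (fun p => (norm_nonneg _).trans (hMtot p a b)) fun F => hBtot F a b)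
  have hGσ := hG.hasSum
  -- level-N majorant family and its sum m N
  have hlevG : ∀ N : ℕ, Summable fun v : (Fin N → ι) × W₀ => Mtot (List.ofFn v.1, v.2) a b := fun N =>
    (hG.comp_injective (sigma_mk_injective (i := N))).congr fun v => by simp [Function.comp, he]
  have hm : HasSum (fun N : ℕ => ∑' v : (Fin N → ι) × W₀, Mtot (List.ofFn v.1, v.2) a b) (∑' p, ((fun p : List ι × W₀ => Mtot p a b) ∘ e) p) :=
    hGσ.sigma fun N => by simpa [Function.comp, he] using (hlevG N).hasSum
  have hm0 := hm.summable.tendsto_atTop_zero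
  -- the level-N sum of the chain family is bounded by m N
  have hlev := hasSum_chain_level hS hσS hBS hT
    (M := fun N v k b => Mtot (List.ofFn v.1, v.2) k b) (fun N v k b => hMtot (List.ofFn v.1, v.2) k b)
    (BM := fun _ k b => Btot k b) (by
      intro N F k b
      have hinj : Set.InjOn (fun v : (Fin N → ι) × W₀ => ((List.ofFn v.1, v.2) : List ι × W₀)) ↑F := by
        intro v _ w _ h
        simp only [Prod.mk.injEq, List.ofFn_inj] at h
        exact Prod.ext h.1 h.2
      rw [← Finset.sum_image (f := fun p : List ι × W₀ => Mtot p k b) hinj]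
      exact hBtot _ k b)
  have hbound : ∀ N : ℕ, ‖(K ^ N * C : Matrix n q ℂ) a b‖ ≤ ∑' v : (Fin N → ι) × W₀, Mtot (List.ofFn v.1, v.2) a b :=
    fun N => (hlev N a b).norm_le_of_bounded (hlevG N).hasSum fun v => hMtot (List.ofFn v.1, v.2) a b
  exact squeeze_zero_norm hbound hm0

/-- **THE RESOLVENT IDENTITY `(1 − K)·X = C`** for the family's sum `X` (entrywise `Σ' (l,ω) chain(l,ω)`), since
the Neumann remainder dies (`tendsto_level_zero`).  Telescoping
`(1 − K)·Σ_{N<M} K^N C = C − K^M C`. [cite: Balaban1985BackgroundPropagators, (3.130) p.421] -/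
theorem one_sub_mul_tsum_eq {S : ι → Matrix n n ℂ} {K : Matrix n n ℂ} {T : W₀ → Matrix n q ℂ} {C : Matrix n q ℂ}
    (hS : ∀ a k, HasSum (fun i => S i a k) (K a k))
    {σS : ι → n → n → ℝ} (hσS : ∀ i a k, ‖S i a k‖ ≤ σS i a k) {BS : n → n → ℝ}
    (hBS : ∀ (F : Finset ι) a k, ∑ i ∈ F, σS i a k ≤ BS a k)
    (hT : ∀ k b, HasSum (fun ω => T ω k b) (C k b))
    {Mtot : List ι × W₀ → n → q → ℝ}
    (hMtot : ∀ (p : List ι × W₀) k b, ‖(p.1.foldr (fun i A => S i * A) (T p.2)) k b‖ ≤ Mtot p k b)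
    {Btot : n → q → ℝ} (hBtot : ∀ (F : Finset (List ι × W₀)) k b, ∑ p ∈ F, Mtot p k b ≤ Btot k b) :
    (1 - K) * (Matrix.of fun k b => ∑' p : List ι × W₀, (p.1.foldr (fun i A => S i * A) (T p.2)) k b) = C := by
  classical
  set X : Matrix n q ℂ := Matrix.of fun k b => ∑' p : List ι × W₀, (p.1.foldr (fun i A => S i * A) (T p.2)) k b with hX
  have hlev : ∀ k b, HasSum (fun N : ℕ => (K ^ N * C : Matrix n q ℂ) k b) (X k b) := fun k b =>
    (hasSum_levels hS hσS hBS hT hMtot hBtot k b).2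
  have hrem : ∀ k b, Filter.Tendsto (fun N : ℕ => (K ^ N * C : Matrix n q ℂ) k b) Filter.atTop (nhds 0) :=
    fun k b => tendsto_level_zero hS hσS hBS hT hMtot hBtot k b
  ext a b
  -- the entry (a,b) of (1 − K)·X as a sum over the levels
  have h1 : HasSum (fun N : ℕ => ∑ k, (1 - K : Matrix n n ℂ) a k * (K ^ N * C : Matrix n q ℂ) k b) (((1 - K) * X : Matrix n q ℂ) a b) := by
    rw [Matrix.mul_apply]
    exact hasSum_sum fun k _ => (hlev k b).mul_left _
  have h2 : ∀ N : ℕ, ∑ k, (1 - K : Matrix n n ℂ) a k * (K ^ N * C : Matrix n q ℂ) k b =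
      (K ^ N * C : Matrix n q ℂ) a b - (K ^ (N + 1) * C : Matrix n q ℂ) a b := by
    intro N
    rw [← Matrix.mul_apply, Matrix.sub_mul, Matrix.one_mul, Matrix.sub_apply, pow_succ', Matrix.mul_assoc]
  simp_rw [h2] at h1
  -- partial sums telescope to `C a b − (K^M C) a b`, which tends to `C a b`
  have h3 : Filter.Tendsto (fun M : ℕ => ∑ N ∈ Finset.range M, ((K ^ N * C : Matrix n q ℂ) a b - (K ^ (N + 1) * C : Matrix n q ℂ) a b))
      Filter.atTop (nhds (((1 - K) * X : Matrix n q ℂ) a b)) := h1.tendsto_sum_nat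
  have h4 : (fun M : ℕ => ∑ N ∈ Finset.range M, ((K ^ N * C : Matrix n q ℂ) a b - (K ^ (N + 1) * C : Matrix n q ℂ) a b)) =
      fun M => (K ^ 0 * C : Matrix n q ℂ) a b - (K ^ M * C : Matrix n q ℂ) a b := by
    funext M
    exact Finset.sum_range_sub' (fun N => (K ^ N * C : Matrix n q ℂ) a b) M
  rw [h4] at h3
  have h5 : Filter.Tendsto (fun M : ℕ => (K ^ 0 * C : Matrix n q ℂ) a b - (K ^ M * C : Matrix n q ℂ) a b) Filter.atTop
      (nhds ((K ^ 0 * C : Matrix n q ℂ) a b - 0)) :=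
    tendsto_const_nhds.sub (hrem a b)
  have h6 := tendsto_nhds_unique h3 h5
  rw [h6, sub_zero, pow_zero, Matrix.one_mul]

end Summit.QuantumFields.BalabanUV.T4Continuum.Spine.NE5.NeumannLevelSums

end
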